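import Summits.HodgeConjecture.HodgeConjecture.Theorems.K2E3SplitPlaceGRegularCriterion        -- ★ p855356 (this seat): `isLocalGRegular_of_cmSplitEquiv`
import Summits.HodgeConjecture.HodgeConjecture.Theorems.K2E4ExplicitSplitConstantPhaseKit        -- ★ p854972 (this seat): `exists_smul_ne_of_not_subsingleton`, `coe_fst_local_eq_smul_one`
import Summits.HodgeConjecture.HodgeConjecture.Theorems.K2E4ExplicitSplitConstantPhasePair       -- ★ p855004 (this seat): `isHaarMeasure_of_ne_zero`
import Literature.NumberTheory.Rogawski1990.SmoothTransferSplitPlace                              -- ★ B5-A currency: instances on `H_v`, `GL_N(L_w)`; transitively B5-L `classOrbitalIntegral_comp_mulEquiv_eq_orbitalIntegral_of_isCanonical`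
import Literature.NumberTheory.Rogawski1990.LocalTransferSplitPlaceClasses                        -- ★ `stableOrbitalIntegralRel_isLocalStablyConjH_eq_of_split`
import Literature.NumberTheory.Rogawski1990.GRegularLocalisation                                  -- ★ `isLocalGRegular_out_mk`
import Literature.NumberTheory.Rogawski1990.TamagawaSingularMembersFinTFCovol                     -- ★ frame vocabulary of socket U3b-a (`IsLocalTransferDatum`, `IsCanonical`, …)
import Literature.NumberTheory.Automorphic.GLnLeviSmoothTransport                                 -- ★ `IsLocSmooth.comp_homeomorph'`
import Literature.NumberTheory.Automorphic.UnitaryGroupOfLocalCovolumeStableKit                   -- ★ `ne_zero_of_quotientMeasure_ne_zero`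
import Literature.NumberTheory.Automorphic.AdicCompletionLocalField                               -- ★ `IsNonarchimedeanLocalField (w.adicCompletion L)`
import Mathlib.NumberTheory.LocalField.Basic
import HarnessLib

/-!
# Socket U3b-a `sig_K2E3CentralTransferVanishing` AT A SPLIT PLACE, reduced to the Harish-Chandra density statement (HC₁^P) on
# `P = GL₂(L_w) × GL₁(L_w)` (Rogawski 1990, §4.3 (4.3.1) p. 43, §4.9 pp. 54–55, §8.1 p. 116)

Cell `pub/hodgecm-mathlib`, squad K2 (engine E3, dealer K2E3-plan (g1) BATCH #2 22:15:20Z «K2E4-p02 → (B)∣split»), seat K2E4-p02 (g0);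
`--supports stmt-HodgeConjecture-24833 --as helper`.  THEOREMS ONLY (no definition, no named fact, no instance, no `sorry`).

THE REDUCTION `T0`.  Socket U3b-a (= (B_v), `Cruxes/H413/Lines/K2_E3_EllipticInputsSigs_U3bCentralGerms.lean` :48, K2E4-p01 cand
41d1ce4405d4c678) says: a smooth `gH` on `H_v = U(Φ₂)(L⁺_v) × U(Φ₁)(L⁺_v)` such that `(gH, 0)` is a `Δ_v`-transfer pair vanishes at
`(γ_H)_v`, `γ_H = (e₁·1₂, γ_H.2)`.  At a place `v` SPLIT in `L` (`¬ Subsingleton (PlacesOver L v)`; the guard is inserted in the slot where the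
non-split twin U3b-b carries `Subsingleton …`) this is the following chain, typed here:
1. `(gH, 0)` a transfer pair ⇒ `Φ^{st}_H((γ)_v, gH) = 0` at every `G`-regular `γ ∈ H_v` (★ `IsLocalDeltaTransfer` unfolded; the `G′`-side of
   (4.3.1) is `Σ Δ · Φ(·, 0) = 0`); at a split place stable conjugacy in `H_v` is conjugacy, so the CLASS orbital integral of `gH` vanishes at every
   `G`-regular class (★ `stableOrbitalIntegralRel_isLocalStablyConjH_eq_of_split`).
2. `ν_{H,v} ≠ 0` (the family `mH_v` is admissible AND canonical at the `G`-regular classes, ★ `IsLocalTransferDatum`, `IsCanonical`,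
   `ne_zero_of_quotientMeasure_ne_zero`; a `G`-regular class exists by ★ p855356), hence a Haar measure (★ `isHaarMeasure_of_ne_zero`).
3. Transport along `j = (cmSplitEquivTwo, cmSplitEquivOne) : H_v ≃ₜ* P := GL₂(L_w) × GL₁(L_w)` (★ B5-L
   `classOrbitalIntegral_comp_mulEquiv_eq_orbitalIntegral_of_isCanonical`): for `ψ := gH ∘ j⁻¹` and every `(h, u) ∈ P` with `(tr h)² − 4 det h ≠ 0`,
   `χ_h(u) ≠ 0` — so that `j⁻¹(h, u)` is `G`-regular, ★ p855356 `isLocalGRegular_of_cmSplitEquiv` — the orbital integral of `ψ` at `(h, u)` against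
   `(j_* ν_{H,v}) ∕ ρ` vanishes for EVERY canonically normalised `ρ`.
4. (HC₁^P) (hypothesis `hHC`; K2E4-p01 (g2)'s core `K2E3GLTwoCentralDensityRamifiedTorus.apply_scalar_eq_zero_of_forall_orbitalIntegral_eq_zero`,
   interface bytes `K2/K2E4-p01/g2/HC1P.sig.lean` 22:40Z, instantiated at `F := L_w`) gives `ψ(z·1₂, c) = 0` for all `z, c ∈ L_wˣ`; and
   `j((γ_H)_v) = (e₁·1₂, (γ_H.2)_w)` (★ `coe_fst_local_eq_smul_one`), so `gH((γ_H)_v) = ψ(j (γ_H)_v) = 0`.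

* **`centralTransferVanishing_split_of_HC1P : (HC₁^P for every non-archimedean local field F : Type) → ‹U3b-a bytes ∣ split›`**.
When the core lands, `‹U3b-a ∣ split›` is `centralTransferVanishing_split_of_HC1P (fun … => K2E3GLTwoCentralDensityRamifiedTorus.apply_scalar_eq_zero_of_forall_orbitalIntegral_eq_zero …)`.

HONEST LABEL: HC_CM is proved only modulo the 7 printed citations (2 remaining named inputs: hLiu418 = stmt-HodgeConjecture-24832, h413 =
stmt-HodgeConjecture-24833) until rung 0 closes; this file pays none of them and (HC₁^P) is a HYPOTHESIS here.

## References
* [Rogawski1990] J. D. Rogawski, *Automorphic Representations of Unitary Groups in Three Variables*, Ann. of Math. Stud. 123 (1990), §4.3 (4.3.1) p. 43,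
  §4.9 pp. 54–55, §8.1 Prop. 8.1.3 p. 116.
* [HarishChandra1999AdmissibleDistributions] Harish-Chandra, *Admissible invariant distributions on reductive p-adic groups* (notes by DeBacker–Sally),
  AMS ULS 16 (1999), Thm. 3.1.
* [DeitmarEchterhoff2014] A. Deitmar, S. Echterhoff, *Principles of Harmonic Analysis*, 2nd ed. (2014), Thm. 1.5.3.
-/

set_option autoImplicit false

set_option linter.dupNamespace false

noncomputable section

open MeasureTheory Measure NumberField IsDedekindDomain Matrix Polynomial
open Literature.MeasureTheory.Group
open Literature.NumberTheory.Rogawski1990 Literature.NumberTheory.Automorphic Literature.NumberTheory.GaloisRepresentations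
open Literature.AlgebraicGeometry.ShimuraVarieties (unitaryGroup hermForm)
open scoped MatrixGroups

namespace Summit.HodgeConjecture.HodgeConjecture.Cruxes.H413.K2E3CentralTransferVanishingSplit

set_option maxHeartbeats 1600000 in
set_option synthInstance.maxHeartbeats 400000 in
/-- **Socket U3b-a at a split place from (HC₁^P).**  If the Harish-Chandra density statement (HC₁^P) holds on `GL₂(F) × GL₁(F)` for every
non-archimedean local field `F` (hypothesis `hHC`, the bytes of `K2E3GLTwoCentralDensityRamifiedTorus.apply_scalar_eq_zero_of_forall_orbitalIntegral_eq_zero`),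
then at every finite place `v` of `L⁺` split in `L`, every smooth `gH` on `H_v` with `(gH, 0)` a `Δ_v`-transfer pair vanishes at `(γ_H)_v`,
`γ_H = (e₁·1₂, γ_H.2)`. [cite: Rogawski1990, §4.3 (4.3.1) p. 43; §4.9 pp. 54–55; §8.1 p. 116] [cite: HarishChandra1999AdmissibleDistributions, Thm. 3.1] -/
theorem centralTransferVanishing_split_of_HC1P
    (hHC : ∀ {F : Type} [Field F] [ValuativeRel F] [TopologicalSpace F] [IsNonarchimedeanLocalField F]
      [MeasurableSpace (GL (Fin 2) F × GL (Fin 1) F)] [BorelSpace (GL (Fin 2) F × GL (Fin 1) F)]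
      [T2Space (GL (Fin 2) F × GL (Fin 1) F)] [LocallyCompactSpace (GL (Fin 2) F × GL (Fin 1) F)]
      [SecondCountableTopology (GL (Fin 2) F × GL (Fin 1) F)]
      [∀ γ : GL (Fin 2) F × GL (Fin 1) F,
        MeasurableSpace ((GL (Fin 2) F × GL (Fin 1) F) ⧸ Subgroup.centralizer ({γ} : Set (GL (Fin 2) F × GL (Fin 1) F)))]
      [∀ γ : GL (Fin 2) F × GL (Fin 1) F,
        BorelSpace ((GL (Fin 2) F × GL (Fin 1) F) ⧸ Subgroup.centralizer ({γ} : Set (GL (Fin 2) F × GL (Fin 1) F)))]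
      (ν : Measure (GL (Fin 2) F × GL (Fin 1) F)) [ν.IsHaarMeasure] [ν.IsMulRightInvariant]
      (ψ : GL (Fin 2) F × GL (Fin 1) F → ℂ), IsLocSmooth ψ →
      (∀ (h : GL (Fin 2) F) (u : GL (Fin 1) F),
        (h : Matrix (Fin 2) (Fin 2) F).trace ^ 2 - 4 * (h : Matrix (Fin 2) (Fin 2) F).det ≠ 0 →
        ((h : Matrix (Fin 2) (Fin 2) F).charpoly).eval ((u : Matrix (Fin 1) (Fin 1) F) 0 0) ≠ 0 →
        ∀ (ρ : Measure (Subgroup.centralizer ({(h, u)} : Set (GL (Fin 2) F × GL (Fin 1) F))))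
          [ρ.IsHaarMeasure] [ρ.IsInvInvariant],
          ρ (compactCore (Subgroup.centralizer ({(h, u)} : Set (GL (Fin 2) F × GL (Fin 1) F)))) = 1 →
          orbitalIntegral (h, u) ψ
            (quotientMeasure (Subgroup.centralizer ({(h, u)} : Set (GL (Fin 2) F × GL (Fin 1) F))) ρ
              (isClosed_coe_centralizer_singleton (h, u)) ν) = 0) →
      ∀ (z c : Fˣ),
        ψ (Units.map (Matrix.scalar (Fin 2) : F →+* Matrix (Fin 2) (Fin 2) F).toMonoidHom z,
           Units.map (Matrix.scalar (Fin 1) : F →+* Matrix (Fin 1) (Fin 1) F).toMonoidHom c) = 0) :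
    ∀ (L : Type) [Field L] [NumberField L] [IsCMField L] (H' : Matrix (Fin 3) (Fin 3) L),
      (H'.map (cmConjRingHom L)).transpose = H' →
      (∀ x : Fin 3 → L, hermForm (cmConjRingHom L) H' x x = 0 → x = 0) →
    ∀ (v : HeightOneSpectrum (𝓞 ↥(maximalRealSubfield L)))
      [MeasurableSpace ((UnitaryGroup.cmDatum L 2 (Matrix.of fun i j : Fin 2 => if i.val + j.val + 1 = 2 then (1 : L) else 0)).Local v × (UnitaryGroup.cmDatum L 1 (Matrix.of fun i j : Fin 1 => if i.val + j.val + 1 = 1 then (1 : L) else 0)).Local v)] [BorelSpace ((UnitaryGroup.cmDatum L 2 (Matrix.of fun i j : Fin 2 => if i.val + j.val + 1 = 2 then (1 : L) else 0)).Local v × (UnitaryGroup.cmDatum L 1 (Matrix.of fun i j : Fin 1 => if i.val + j.val + 1 = 1 then (1 : L) else 0)).Local v)]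
      [∀ a : (UnitaryGroup.cmDatum L 2 (Matrix.of fun i j : Fin 2 => if i.val + j.val + 1 = 2 then (1 : L) else 0)).Local v × (UnitaryGroup.cmDatum L 1 (Matrix.of fun i j : Fin 1 => if i.val + j.val + 1 = 1 then (1 : L) else 0)).Local v,
        MeasurableSpace (((UnitaryGroup.cmDatum L 2 (Matrix.of fun i j : Fin 2 => if i.val + j.val + 1 = 2 then (1 : L) else 0)).Local v × (UnitaryGroup.cmDatum L 1 (Matrix.of fun i j : Fin 1 => if i.val + j.val + 1 = 1 then (1 : L) else 0)).Local v) ⧸ Subgroup.centralizer ({a} : Set ((UnitaryGroup.cmDatum L 2 (Matrix.of fun i j : Fin 2 => if i.val + j.val + 1 = 2 then (1 : L) else 0)).Local v × (UnitaryGroup.cmDatum L 1 (Matrix.of fun i j : Fin 1 => if i.val + j.val + 1 = 1 then (1 : L) else 0)).Local v)))]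
      [∀ a : (UnitaryGroup.cmDatum L 2 (Matrix.of fun i j : Fin 2 => if i.val + j.val + 1 = 2 then (1 : L) else 0)).Local v × (UnitaryGroup.cmDatum L 1 (Matrix.of fun i j : Fin 1 => if i.val + j.val + 1 = 1 then (1 : L) else 0)).Local v,
        BorelSpace (((UnitaryGroup.cmDatum L 2 (Matrix.of fun i j : Fin 2 => if i.val + j.val + 1 = 2 then (1 : L) else 0)).Local v × (UnitaryGroup.cmDatum L 1 (Matrix.of fun i j : Fin 1 => if i.val + j.val + 1 = 1 then (1 : L) else 0)).Local v) ⧸ Subgroup.centralizer ({a} : Set ((UnitaryGroup.cmDatum L 2 (Matrix.of fun i j : Fin 2 => if i.val + j.val + 1 = 2 then (1 : L) else 0)).Local v × (UnitaryGroup.cmDatum L 1 (Matrix.of fun i j : Fin 1 => if i.val + j.val + 1 = 1 then (1 : L) else 0)).Local v)))]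
      [MeasurableSpace ((UnitaryGroup.cmDatum L 3 H').Local v)] [BorelSpace ((UnitaryGroup.cmDatum L 3 H').Local v)]
      [∀ γ : (UnitaryGroup.cmDatum L 3 H').Local v, MeasurableSpace ((UnitaryGroup.cmDatum L 3 H').Local v ⧸ Subgroup.centralizer ({γ} : Set ((UnitaryGroup.cmDatum L 3 H').Local v)))]
      [∀ γ : (UnitaryGroup.cmDatum L 3 H').Local v, BorelSpace ((UnitaryGroup.cmDatum L 3 H').Local v ⧸ Subgroup.centralizer ({γ} : Set ((UnitaryGroup.cmDatum L 3 H').Local v)))]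
      (νHv : Measure ((UnitaryGroup.cmDatum L 2 (Matrix.of fun i j : Fin 2 => if i.val + j.val + 1 = 2 then (1 : L) else 0)).Local v × (UnitaryGroup.cmDatum L 1 (Matrix.of fun i j : Fin 1 => if i.val + j.val + 1 = 1 then (1 : L) else 0)).Local v)) (νGv : Measure ((UnitaryGroup.cmDatum L 3 H').Local v))
      [IsFiniteMeasureOnCompacts νHv] [νHv.IsMulRightInvariant] [νGv.IsHaarMeasure] [νGv.IsMulRightInvariant]
      (Δv : LocalTransferFactor L H' v)
      (mHv : OrbitalMeasureFamily ((UnitaryGroup.cmDatum L 2 (Matrix.of fun i j : Fin 2 => if i.val + j.val + 1 = 2 then (1 : L) else 0)).Local v × (UnitaryGroup.cmDatum L 1 (Matrix.of fun i j : Fin 1 => if i.val + j.val + 1 = 1 then (1 : L) else 0)).Local v)) (mGv : OrbitalMeasureFamily ((UnitaryGroup.cmDatum L 3 H').Local v)),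
      IsLocalTransferDatum L H' v Δv mHv mGv →
      mHv.IsCanonical (IsLocalGRegular L v) νHv →
      mGv.IsCanonical (fun γ : (UnitaryGroup.cmDatum L 3 H').Local v => IsRegularElt (γ.val : GL (Fin 3) (UnitaryGroup.LocalRing L v))) νGv →
      ¬ Subsingleton (UnitaryGroup.PlacesOver L v) →
    ∀ (γH : (UnitaryGroup.cmDatum L 2 (Matrix.of fun i j : Fin 2 => if i.val + j.val + 1 = 2 then (1 : L) else 0)).Rational × (UnitaryGroup.cmDatum L 1 (Matrix.of fun i j : Fin 1 => if i.val + j.val + 1 = 1 then (1 : L) else 0)).Rational) (e₁ : L),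
      (((γH.1 : unitaryGroup (cmConjRingHom L) (Matrix.of fun i j : Fin 2 => if i.val + j.val + 1 = 2 then (1 : L) else 0)).val : GL (Fin 2) L) : Matrix (Fin 2) (Fin 2) L) =
        e₁ • (1 : Matrix (Fin 2) (Fin 2) L) →
    ∀ gH : (UnitaryGroup.cmDatum L 2 (Matrix.of fun i j : Fin 2 => if i.val + j.val + 1 = 2 then (1 : L) else 0)).Local v × (UnitaryGroup.cmDatum L 1 (Matrix.of fun i j : Fin 1 => if i.val + j.val + 1 = 1 then (1 : L) else 0)).Local v → ℂ, IsLocSmooth gH → IsLocalDeltaTransfer L H' v Δv mHv mGv gH 0 →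
      gH ((UnitaryGroup.cmDatum L 2 (Matrix.of fun i j : Fin 2 => if i.val + j.val + 1 = 2 then (1 : L) else 0)).toLocal v ((UnitaryGroup.cmDatum L 2 (Matrix.of fun i j : Fin 2 => if i.val + j.val + 1 = 2 then (1 : L) else 0)).toAdelic γH.1),
        (UnitaryGroup.cmDatum L 1 (Matrix.of fun i j : Fin 1 => if i.val + j.val + 1 = 1 then (1 : L) else 0)).toLocal v ((UnitaryGroup.cmDatum L 1 (Matrix.of fun i j : Fin 1 => if i.val + j.val + 1 = 1 then (1 : L) else 0)).toAdelic γH.2)) = 0 := by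
  intro L _ _ _ H' hherm hanis v _ _ _ _ _ _ _ _ νHv νGv _ _ _ _ Δv mHv mGv hdat hcanH hcanG hns γH e₁ hγH₁ gH hgH htr
  classical
  -- (0) a split witness `w`, the local field `F = L_w`, the target group `P = GL₂(F) × GL₁(F)` and its structures
  obtain ⟨w, hw⟩ := K2E4ExplicitSplitConstantPhase.exists_smul_ne_of_not_subsingleton L v hns
  haveI : LocallyCompactSpace (GL (Fin 2) (w.1.adicCompletion L)) := UnitaryGroup.locallyCompactSpace_gl_adicCompletion L 2 w.1
  haveI : LocallyCompactSpace (GL (Fin 1) (w.1.adicCompletion L)) := UnitaryGroup.locallyCompactSpace_gl_adicCompletion L 1 w.1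
  haveI : SecondCountableTopology (GL (Fin 2) (w.1.adicCompletion L)) := UnitaryGroup.secondCountableTopology_gl_adicCompletion L 2 w.1
  haveI : SecondCountableTopology (GL (Fin 1) (w.1.adicCompletion L)) := UnitaryGroup.secondCountableTopology_gl_adicCompletion L 1 w.1
  letI : MeasurableSpace (GL (Fin 2) (w.1.adicCompletion L) × GL (Fin 1) (w.1.adicCompletion L)) := borel _
  haveI : BorelSpace (GL (Fin 2) (w.1.adicCompletion L) × GL (Fin 1) (w.1.adicCompletion L)) := ⟨rfl⟩
  letI : ∀ γ : GL (Fin 2) (w.1.adicCompletion L) × GL (Fin 1) (w.1.adicCompletion L),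
      MeasurableSpace ((GL (Fin 2) (w.1.adicCompletion L) × GL (Fin 1) (w.1.adicCompletion L)) ⧸
        Subgroup.centralizer ({γ} : Set (GL (Fin 2) (w.1.adicCompletion L) × GL (Fin 1) (w.1.adicCompletion L)))) := fun _ => borel _
  haveI : ∀ γ : GL (Fin 2) (w.1.adicCompletion L) × GL (Fin 1) (w.1.adicCompletion L),
      BorelSpace ((GL (Fin 2) (w.1.adicCompletion L) × GL (Fin 1) (w.1.adicCompletion L)) ⧸
        Subgroup.centralizer ({γ} : Set (GL (Fin 2) (w.1.adicCompletion L) × GL (Fin 1) (w.1.adicCompletion L)))) := fun _ => ⟨rfl⟩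
  -- the frame `j = (j₂, j₁) : H_v ≃ₜ* P`
  let jj : ((UnitaryGroup.cmDatum L 2 (Matrix.of fun i j : Fin 2 => if i.val + j.val + 1 = 2 then (1 : L) else 0)).Local v ×
      (UnitaryGroup.cmDatum L 1 (Matrix.of fun i j : Fin 1 => if i.val + j.val + 1 = 1 then (1 : L) else 0)).Local v) ≃ₜ* (GL (Fin 2) (w.1.adicCompletion L) × GL (Fin 1) (w.1.adicCompletion L)) :=
    { toMulEquiv := MulEquiv.prodCongr (UnitaryGroup.cmSplitEquivTwo L v w hw).toMulEquiv (UnitaryGroup.cmSplitEquivOne L v w hw).toMulEquiv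
      continuous_toFun := (UnitaryGroup.cmSplitEquivTwo L v w hw).continuous.prodMap (UnitaryGroup.cmSplitEquivOne L v w hw).continuous
      continuous_invFun :=
        (UnitaryGroup.cmSplitEquivTwo L v w hw).symm.continuous.prodMap (UnitaryGroup.cmSplitEquivOne L v w hw).symm.continuous }
  have hjj : ∀ x, jj x = (UnitaryGroup.cmSplitEquivTwo L v w hw x.1, UnitaryGroup.cmSplitEquivOne L v w hw x.2) := fun _ => rfl
  have hjjs : ∀ p, jj.symm p = ((UnitaryGroup.cmSplitEquivTwo L v w hw).symm p.1, (UnitaryGroup.cmSplitEquivOne L v w hw).symm p.2) :=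
    fun _ => rfl
  -- (1) `G`-regularity of `j⁻¹(h, u)` under the two guards (★ p855356)
  have hreg : ∀ (h : GL (Fin 2) (w.1.adicCompletion L)) (u : GL (Fin 1) (w.1.adicCompletion L)),
      (h : Matrix (Fin 2) (Fin 2) (w.1.adicCompletion L)).trace ^ 2 - 4 * (h : Matrix (Fin 2) (Fin 2) (w.1.adicCompletion L)).det ≠ 0 →
      ((h : Matrix (Fin 2) (Fin 2) (w.1.adicCompletion L)).charpoly).eval ((u : Matrix (Fin 1) (Fin 1) (w.1.adicCompletion L)) 0 0) ≠ 0 →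
      IsLocalGRegular L v (jj.symm (h, u)) := by
    intro h u hd he
    have h1 : UnitaryGroup.cmSplitEquivTwo L v w hw (jj.symm (h, u)).1 = h := by
      rw [hjjs]; exact (UnitaryGroup.cmSplitEquivTwo L v w hw).apply_symm_apply h
    have h2 : UnitaryGroup.cmSplitEquivOne L v w hw (jj.symm (h, u)).2 = u := by
      rw [hjjs]; exact (UnitaryGroup.cmSplitEquivOne L v w hw).apply_symm_apply u
    refine isLocalGRegular_of_cmSplitEquiv L v (jj.symm (h, u)) w hw ?_ ?_
    · rw [h1]; exact hd
    · rw [h1, h2]; exact he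
  -- (2) `ν_{H,v} ≠ 0`: the canonical member at the `G`-regular class of `j⁻¹(h₀, u₀)`, `h₀ = antidiag(1,1)`, `u₀ = 2`, is non-zero
  haveI : CharZero (w.1.adicCompletion L) := charZero_of_injective_algebraMap (algebraMap L (w.1.adicCompletion L)).injective
  have hν0 : νHv ≠ 0 := by
    have hd0 : (!![(0 : w.1.adicCompletion L), 1; 1, 0]).det ≠ 0 := by
      rw [Matrix.det_fin_two_of]; norm_num
    set h₀ : GL (Fin 2) (w.1.adicCompletion L) := Matrix.GeneralLinearGroup.mkOfDetNeZero _ hd0 with hh₀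
    set u₀ : GL (Fin 1) (w.1.adicCompletion L) :=
      Units.map (Matrix.scalar (Fin 1) : w.1.adicCompletion L →+* Matrix (Fin 1) (Fin 1) (w.1.adicCompletion L)).toMonoidHom
        (Units.mk0 (2 : w.1.adicCompletion L) two_ne_zero) with hu₀
    have hh₀v : (h₀ : Matrix (Fin 2) (Fin 2) (w.1.adicCompletion L)) = !![(0 : w.1.adicCompletion L), 1; 1, 0] := rfl
    have hu₀v : ((u₀ : Matrix (Fin 1) (Fin 1) (w.1.adicCompletion L)) 0 0) = 2 := by
      rw [hu₀]; simp [Matrix.scalar_apply]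
    have hreg₀ : IsLocalGRegular L v (jj.symm (h₀, u₀)) := by
      refine hreg h₀ u₀ ?_ ?_
      · rw [hh₀v, Matrix.trace_fin_two_of, Matrix.det_fin_two_of]; norm_num
      · rw [hu₀v, hh₀v, Matrix.charpoly_fin_two]
        simp only [eval_add, eval_sub, eval_mul, eval_pow, eval_X, eval_C, Matrix.trace_fin_two_of, Matrix.det_fin_two_of]
        norm_num
    have hP₀ := isLocalGRegular_out_mk hreg₀
    have hm0 := hdat.2.1.ne_zero hP₀
    obtain ⟨t, ht, hti, -, hm⟩ := hcanH _ hP₀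
    exact ne_zero_of_quotientMeasure_ne_zero _ (isClosed_coe_centralizer_singleton _) t νHv hm hm0
  haveI : νHv.IsHaarMeasure := K2E4ExplicitSplitConstantPhase.isHaarMeasure_of_ne_zero L v νHv hν0
  -- (3) the transported measure `j_* ν_{H,v}` and test function `ψ = gH ∘ j⁻¹`
  haveI : IsHaarMeasure (Measure.map jj νHv) := jj.isHaarMeasure_map νHv
  haveI : (Measure.map jj νHv).IsMulRightInvariant :=
    isMulRightInvariant_map_mulEquiv_of_isMulRightInvariant jj.toMulEquiv jj.continuous.measurable νHv
  have hψ : IsLocSmooth (fun p : GL (Fin 2) (w.1.adicCompletion L) × GL (Fin 1) (w.1.adicCompletion L) => gH (jj.symm p)) :=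
    hgH.comp_homeomorph' jj.symm.toHomeomorph
  -- (4) every guarded orbital integral of `ψ` vanishes
  have hO : ∀ (h : GL (Fin 2) (w.1.adicCompletion L)) (u : GL (Fin 1) (w.1.adicCompletion L)),
      (h : Matrix (Fin 2) (Fin 2) (w.1.adicCompletion L)).trace ^ 2 - 4 * (h : Matrix (Fin 2) (Fin 2) (w.1.adicCompletion L)).det ≠ 0 →
      ((h : Matrix (Fin 2) (Fin 2) (w.1.adicCompletion L)).charpoly).eval ((u : Matrix (Fin 1) (Fin 1) (w.1.adicCompletion L)) 0 0) ≠ 0 →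
      ∀ (ρ : Measure (Subgroup.centralizer ({(h, u)} : Set (GL (Fin 2) (w.1.adicCompletion L) × GL (Fin 1) (w.1.adicCompletion L)))))
        [ρ.IsHaarMeasure] [ρ.IsInvInvariant],
        ρ (compactCore (Subgroup.centralizer ({(h, u)} : Set (GL (Fin 2) (w.1.adicCompletion L) × GL (Fin 1) (w.1.adicCompletion L))))) = 1 →
        orbitalIntegral (h, u) (fun p => gH (jj.symm p))
          (quotientMeasure (Subgroup.centralizer ({(h, u)} : Set (GL (Fin 2) (w.1.adicCompletion L) × GL (Fin 1) (w.1.adicCompletion L)))) ρ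
            (isClosed_coe_centralizer_singleton (h, u)) (Measure.map jj νHv)) = 0 := by
    intro h u hd he
    have hrega : IsLocalGRegular L v (jj.symm (h, u)) := hreg h u hd he
    obtain ⟨a, ha⟩ : ∃ a, jj.toMulEquiv a = (h, u) := ⟨jj.symm (h, u), jj.apply_symm_apply _⟩
    have haa : jj.symm (h, u) = a := by rw [← ha]; exact jj.symm_apply_apply a
    rw [haa] at hrega
    rw [← ha]
    intro ρ _ _ hρ
    have hP : IsLocalGRegular L v (Quotient.out (ConjClasses.mk a)) := isLocalGRegular_out_mk hrega
    have hL := classOrbitalIntegral_comp_mulEquiv_eq_orbitalIntegral_of_isCanonical jj.toMulEquiv jj.continuous jj.symm.continuous hcanH a hP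
      (Measure.map jj νHv) rfl ρ hρ (fun p => gH (jj.symm p))
    rw [← hL]
    have hcomp : ((fun p : GL (Fin 2) (w.1.adicCompletion L) × GL (Fin 1) (w.1.adicCompletion L) => gH (jj.symm p)) ∘ jj.toMulEquiv) = gH := by
      funext x
      simp only [Function.comp_apply]
      exact congrArg gH (jj.symm_apply_apply x)
    rw [hcomp, ← stableOrbitalIntegralRel_isLocalStablyConjH_eq_of_split L w hw (UnitaryGroup.antidiagOne_isHermitian L 2)
      (UnitaryGroup.isUnit_antidiagOne_det L 2).ne_zero (UnitaryGroup.antidiagOne_isHermitian L 1) (UnitaryGroup.isUnit_antidiagOne_det L 1).ne_zero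
      mHv gH a, htr a hrega]
    simp only [classOrbitalIntegral_zero_fun, mul_zero, finsum_zero]
  -- (5) (HC₁^P) at `(z, c) = (e₁, (γ_H.2)_w)`, and `j (γ_H)_v = (e₁·1₂, (γ_H.2)_w)`
  have he₁ : e₁ ≠ 0 := by
    intro h0
    have hu := Matrix.isUnits_det_units ((γH.1 : unitaryGroup (cmConjRingHom L) (Matrix.of fun i j : Fin 2 => if i.val + j.val + 1 = 2 then (1 : L) else 0)).val)
    rw [hγH₁, h0, zero_smul, Matrix.det_zero] at hu
    exact not_isUnit_zero hu
  set z : (w.1.adicCompletion L)ˣ := Units.mk0 (algebraMap L (w.1.adicCompletion L) e₁)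
    ((map_ne_zero_iff _ (algebraMap L (w.1.adicCompletion L)).injective).2 he₁) with hz
  set c : (w.1.adicCompletion L)ˣ := Matrix.GeneralLinearGroup.det (UnitaryGroup.cmSplitEquivOne L v w hw
    ((UnitaryGroup.cmDatum L 1 (Matrix.of fun i j : Fin 1 => if i.val + j.val + 1 = 1 then (1 : L) else 0)).toLocal v
      ((UnitaryGroup.cmDatum L 1 (Matrix.of fun i j : Fin 1 => if i.val + j.val + 1 = 1 then (1 : L) else 0)).toAdelic γH.2))) with hc
  have key := hHC (Measure.map jj νHv) (fun p => gH (jj.symm p)) hψ hO z c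
  have hjγ : jj (((UnitaryGroup.cmDatum L 2 (Matrix.of fun i j : Fin 2 => if i.val + j.val + 1 = 2 then (1 : L) else 0)).toLocal v
        ((UnitaryGroup.cmDatum L 2 (Matrix.of fun i j : Fin 2 => if i.val + j.val + 1 = 2 then (1 : L) else 0)).toAdelic γH.1),
      (UnitaryGroup.cmDatum L 1 (Matrix.of fun i j : Fin 1 => if i.val + j.val + 1 = 1 then (1 : L) else 0)).toLocal v
        ((UnitaryGroup.cmDatum L 1 (Matrix.of fun i j : Fin 1 => if i.val + j.val + 1 = 1 then (1 : L) else 0)).toAdelic γH.2))) =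
      (Units.map (Matrix.scalar (Fin 2) : w.1.adicCompletion L →+* Matrix (Fin 2) (Fin 2) (w.1.adicCompletion L)).toMonoidHom z,
        Units.map (Matrix.scalar (Fin 1) : w.1.adicCompletion L →+* Matrix (Fin 1) (Fin 1) (w.1.adicCompletion L)).toMonoidHom c) := by
    rw [hjj]
    refine Prod.ext (Units.ext ?_) (Units.ext ?_)
    · change ((((UnitaryGroup.cmDatum L 2 (Matrix.of fun i j : Fin 2 => if i.val + j.val + 1 = 2 then (1 : L) else 0)).toLocal v
          ((UnitaryGroup.cmDatum L 2 (Matrix.of fun i j : Fin 2 => if i.val + j.val + 1 = 2 then (1 : L) else 0)).toAdelic γH.1)).val :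
            GL (Fin 2) (UnitaryGroup.LocalRing L v)).val : Matrix (Fin 2) (Fin 2) (UnitaryGroup.LocalRing L v)).map
          (Pi.evalRingHom (fun w : UnitaryGroup.PlacesOver L v => w.1.adicCompletion L) w) =
        Matrix.scalar (Fin 2) (z : w.1.adicCompletion L)
      rw [K2E4ExplicitSplitConstantPhase.coe_fst_local_eq_smul_one L v γH hγH₁, Matrix.map_smul' _ _ _ (map_mul _),
        Matrix.map_one _ (map_zero _) (map_one _), hz, Units.val_mk0, Matrix.scalar_apply, ← Matrix.smul_one_eq_diagonal]
      rfl
    · ext i j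
      fin_cases i; fin_cases j
      rw [hc]
      simp [Matrix.scalar_apply, Matrix.GeneralLinearGroup.val_det_apply]
  have := key
  rw [← hjγ, ContinuousMulEquiv.symm_apply_apply] at this
  exact this

end Summit.HodgeConjecture.HodgeConjecture.Cruxes.H413.K2E3CentralTransferVanishingSplit

end
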